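import Summits.HubbardSuperconductivity.HubbardSuperconductivity.Theorems.AnisotropyChordTransferFibre3RowCLamIncrement
import Summits.HubbardSuperconductivity.HubbardSuperconductivity.Theorems.AnisotropyChordTransferFibre3RowCKernelSubadd
import Summits.HubbardSuperconductivity.HubbardSuperconductivity.Theorems.AnisotropyChordTransferFibre3GroundExplicit

/-!
# Route `AnisotropyChord` / H0 rotor rung: PartN41-C §4 — `GradSupBound` PROVED (`|D_e f(b)| ≤ η_eff + 0.001c_s` off the origin, `L ≥ 128`)

Theory-1 g22's PartN41-C §4 `GradSupBound` (port …Fibre3KT2bRow): off the origin the ground profile is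
`f = Δf_nn + c_s a_λ` (`ground_profile_aKer`), `a_λ = a₀ + δ_λ`, so for `b, b − e ≠ 0`
`|D_e f(b)| ≤ c_s(|a₀(b) − a₀(b − e)| + |δ_λ(b) − δ_λ(b − e)|) ≤ c_s(a₀(e) + 0.001)` by the subadditivity of `a₀`
(`kernelSubadditive_holds`) and `lamIncrementBound_holds`; finally `c_s a₀(e) ≤ c_s a_λ(e) = c_s a_λ(x̂) = (1 − Δ)f_nn = η_eff`
(`δ_λ ≥ 0` by `lamPartShellBound_holds`, the kernel's `D₄` symmetry, the sum rule).  ★ `RowC.grad_sup_bound`,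
★ `gradSupBound_holds : GradSupBound`.
Prover seat `hubbard-h0-rotor-p1` g27 (route lead); helper for stmt-HubbardSuperconductivity-23918 (`--supports`, helper class).
WHAT THIS IS NOT: nothing here proves superconductivity in the Hubbard model; one L-uniform constant of ONE row of ONE
conditional reduction.  Tree imports only; no new definitions; no sorry, no axioms.
-/

set_option linter.dupNamespace false
set_option autoImplicit false

noncomputable section

open scoped BigOperators

namespace Summit.HubbardSuperconductivity.HubbardSuperconductivity.Theorems.AnisotropyChord.Transfer.Fibre3

namespace RowC

open RateLemma

variable (L : ℕ) [NeZero L]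

/-- `|a₀(b) − a₀(b − e)| ≤ a₀(e)` (subadditivity of the `λ = 0` kernel). [folklore] -/
theorem abs_aKer_zero_sub_le (b e : Tor L) : |aKer L 0 b - aKer L 0 (b - e)| ≤ aKer L 0 e := by
  have h1 := kernelSubadditive_holds L (b - e) e
  have h2 := kernelSubadditive_holds L b (-e)
  rw [sub_add_cancel] at h1
  rw [OneHoleTorus.aKer_neg, ← sub_eq_add_neg] at h2
  rw [abs_le]; constructor <;> linarith

/-- `a₀(e) = a₀(x̂)` for every nearest neighbour `e`. [folklore] -/
theorem aKer_nn_eq (lam2 : ℝ) {e : Tor L} (he : e ∈ nnList L) : aKer L lam2 e = aKer L lam2 (ex L) := by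
  simp only [nnList, List.mem_cons, List.mem_nil_iff, or_false] at he
  rw [neg_ex, neg_ey] at he
  have hy : aKer L lam2 (ey L) = aKer L lam2 (ex L) := by
    have e1 : ey L = (((ex L).2, (ex L).1) : Tor L) := rfl
    unfold aKer; rw [e1, Gres_swap]
  rcases he with h | h | h | h
  · rw [h]; rfl
  · rw [h, OneHoleTorus.aKer_neg]
  · rw [h]; exact hy
  · rw [h, OneHoleTorus.aKer_neg]; exact hy

/-- ★ the gradient sup bound (body of `GradSupBound`). [folklore] -/
theorem grad_sup_bound (hL : 128 ≤ L) {Δ lam2 : ℝ} {f : Tor L → ℝ} (hΔ0 : 0 ≤ Δ) (hΔ1 : Δ < 1)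
    (hf : IsGroundTwoMagnon L Δ lam2 f) (hlam : lam2 ≤ 0.0513 * (2 * Real.pi / L) ^ 2)
    {e : Tor L} (he : e ∈ nnList L) {b : Tor L} (hb : b ≠ 0) (hbe : b - e ≠ 0) :
    |Dgrad L f e b| ≤ etaEff L lam2 + 0.001 * cS L Δ lam2 f := by
  have hL5 : 5 ≤ L := by omega
  have hpos := lam2_pos L (by omega) hΔ1 hf.1
  have hl2 := lam2_lt_two_eps1 L hL5 hΔ0 hf
  have hfnn : 0 < f (K1 L) := hf.1.2.2.1
  have hcs : 0 ≤ cS L Δ lam2 f := by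
    have : 0 ≤ 4 * (1 - Δ) + Δ * lam2 := by nlinarith
    unfold cS; exact mul_nonneg hfnn.le this
  -- the profile through the kernel
  have hPb := ground_profile_aKer L hL5 hΔ0 hΔ1 hf hb
  have hPbe := ground_profile_aKer L hL5 hΔ0 hΔ1 hf hbe
  have hPx := ground_profile_aKer L hL5 hΔ0 hΔ1 hf (K1_ne_zero L (by omega))
  -- `c_s a_λ(x̂) = η`
  have hη : cS L Δ lam2 f * aKer L lam2 (K1 L) = etaEff L lam2 := by
    rw [etaEff_eq L (by omega) hf.1]; linarith
  -- split `a_λ = a₀ + δ_λ`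
  have hD : Dgrad L f e b = cS L Δ lam2 f * ((aKer L 0 b - aKer L 0 (b - e))
      + (lamPart L lam2 b - lamPart L lam2 (b - e))) := by
    unfold Dgrad lamPart; rw [hPb, hPbe]; ring
  have h1 := abs_aKer_zero_sub_le L b e
  have h2 := lam_increment_bound L hL hpos.le hlam he b
  -- `a₀(e) ≤ a_λ(e) = a_λ(x̂)`
  have h3 : aKer L 0 e ≤ aKer L lam2 (K1 L) := by
    have hδ := (lamPartShellBound_holds L (by omega) lam2 hpos.le hl2 e).1
    unfold lamPart at hδ
    have hK : K1 L = ex L := rfl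
    rw [hK, ← aKer_nn_eq L lam2 he]
    linarith
  rw [hD, abs_mul, abs_of_nonneg hcs]
  have h4 : |aKer L 0 b - aKer L 0 (b - e) + (lamPart L lam2 b - lamPart L lam2 (b - e))|
      ≤ aKer L lam2 (K1 L) + 0.001 := by
    refine (abs_add_le _ _).trans ?_
    linarith
  calc cS L Δ lam2 f * |aKer L 0 b - aKer L 0 (b - e) + (lamPart L lam2 b - lamPart L lam2 (b - e))|
      ≤ cS L Δ lam2 f * (aKer L lam2 (K1 L) + 0.001) := mul_le_mul_of_nonneg_left h4 hcs
    _ = etaEff L lam2 + 0.001 * cS L Δ lam2 f := by rw [mul_add, hη]; ring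

end RowC

/-- ★ **`GradSupBound` holds.** [folklore] -/
theorem gradSupBound_holds : GradSupBound := by
  intro L _ hL Δ lam2 f hΔ0 hΔ1 hf hlam e he b hb hbe
  exact RowC.grad_sup_bound L hL hΔ0 hΔ1 hf hlam he hb hbe

end Summit.HubbardSuperconductivity.HubbardSuperconductivity.Theorems.AnisotropyChord.Transfer.Fibre3

end
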